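import Mathlib
import Summits.ResolutionOfSingularities.ResolutionOfSingularities.Theorems.WildQuotientsWildQuotientResolutionCubeZeroNormalForm

/-!
# JNF-4: the normal form of a linear `σ` with `(σ − 1)⁴ = 0` on `k[x₁,…,xₙ]`, `n ≤ 4`

Crux stmt-ResolutionOfSingularities-15640 (`WildQuotients.WildQuotientResolution`), line `Sketch`;
chain w45c, the LINEAR sector of `CyclicQuotientFourfolds` (stmt-17941) for every `p`
(res-L1-w45c-stub-3, announced STATUS 2026-08-27 «JNF-4»). [OURS · L1 W4.5c] — linear algebra,
NOT a statement of the manuscript.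

A linear automorphism `σ` of `k[x₁,…,xₙ]`, `n ≤ 4`, with `(σ − 1)⁴ = 0` on the coordinates is
conjugate to: the identity / an LSB datum, or a `J₃`-with-passengers datum (both from JNF-3,
`LinearCubeZero.exists_conj_normalForm_of_cube_zero`, when `(σ − 1)³ = 0`), or — the new case
`(σ − 1)³ ≠ 0`, which forces `n = 4` — the single Jordan block `J₄`:
`x_b ↦ x_b + x_a`, `x_c ↦ x_c + x_b`, `x_d ↦ x_d + x_c`, `x_a ↦ x_a`
(`exists_conj_normalForm_of_pow_four`). Since a linear action of `ℤ/p` in characteristic `p` is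
unipotent, this lists ALL linear `ℤ/p`-actions on `𝔸ⁿ`, `n ≤ 4`: types `1111, 211, 22` (LSB,
landed), `31, 3` (`J₃`: programme V3U), `4` (`J₄`: programme V4U).
-/

-- single-problem summit: the doubled namespace component `ResolutionOfSingularities` is forced
set_option linter.dupNamespace false

noncomputable section

open Module MvPolynomial

namespace Summit.ResolutionOfSingularities.ResolutionOfSingularities.Theorems.WildQuotientResolution.LinearPowFour

section LinearAlgebra

variable {k V : Type*} [Field k] [AddCommGroup V] [Module k V]

/-- If `N⁴ = 0` and `N³ v ≠ 0` then `N³ v, N² v, N v, v` are linearly independent. [folklore] -/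
theorem linearIndependent_of_pow_four (N : V →ₗ[k] V) (hN4 : ∀ x, N (N (N (N x))) = 0) (v : V)
    (hv : N (N (N v)) ≠ 0) : LinearIndependent k ![N (N (N v)), N (N v), N v, v] := by
  rw [Fintype.linearIndependent_iff]
  intro g hg0
  have hg : g 0 • N (N (N v)) + g 1 • N (N v) + g 2 • N v + g 3 • v = 0 := by
    simpa [Fin.sum_univ_four] using hg0
  have h1 : g 1 • N (N (N v)) + g 2 • N (N v) + g 3 • N v = 0 := by
    have h := congrArg N hg
    simpa only [map_add, map_smul, hN4, smul_zero, zero_add, map_zero] using h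
  have h2 : g 2 • N (N (N v)) + g 3 • N (N v) = 0 := by
    have h := congrArg N h1
    simpa only [map_add, map_smul, hN4, smul_zero, zero_add, map_zero] using h
  have h3 : g 3 • N (N (N v)) = 0 := by
    have h := congrArg N h2
    simpa only [map_add, map_smul, hN4, smul_zero, zero_add, map_zero] using h
  have hg3 : g 3 = 0 := (smul_eq_zero.1 h3).resolve_right hv
  have hg2 : g 2 = 0 := by
    rw [hg3, zero_smul, add_zero] at h2
    exact (smul_eq_zero.1 h2).resolve_right hv
  have hg1 : g 1 = 0 := by
    rw [hg2, hg3, zero_smul, zero_smul, add_zero, add_zero] at h1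
    exact (smul_eq_zero.1 h1).resolve_right hv
  have hg0 : g 0 = 0 := by
    rw [hg1, hg2, hg3, zero_smul, zero_smul, zero_smul, add_zero, add_zero, add_zero] at hg
    exact (smul_eq_zero.1 hg).resolve_right hv
  intro i
  fin_cases i <;> assumption

/-- **Jordan normal form for `N⁴ = 0 ≠ N³` in dimension `≤ 4`**: then the dimension is `4` and
`(N³ v, N² v, N v, v)` is a basis — one Jordan block `J₄`. [folklore] -/
theorem exists_basis_of_pow_four [FiniteDimensional k V] (N : V →ₗ[k] V)
    (hN4 : ∀ x, N (N (N (N x))) = 0) (v : V) (hv : N (N (N v)) ≠ 0) {m : ℕ}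
    (hm : Module.finrank k V = m) (hm4 : m ≤ 4) :
    ∃ (B : Basis (Fin m) k V) (a b c d : Fin m), a ≠ b ∧ a ≠ c ∧ a ≠ d ∧ b ≠ c ∧ b ≠ d ∧ c ≠ d ∧
      N (B d) = B c ∧ N (B c) = B b ∧ N (B b) = B a ∧ N (B a) = 0 ∧
      ∀ i, i ≠ b → i ≠ c → i ≠ d → N (B i) = 0 := by
  have hT := linearIndependent_of_pow_four N hN4 v hv
  have h4 : 4 ≤ m := by
    have h := hT.fintype_card_le_finrank
    rw [Fintype.card_fin, hm] at h
    exact h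
  obtain rfl : m = 4 := le_antisymm hm4 h4
  let B : Basis (Fin 4) k V := basisOfLinearIndependentOfCardEqFinrank hT (by rw [hm]; simp)
  have hB : ⇑B = ![N (N (N v)), N (N v), N v, v] := coe_basisOfLinearIndependentOfCardEqFinrank _ _
  refine ⟨B, 0, 1, 2, 3, by decide, by decide, by decide, by decide, by decide, by decide,
    ?_, ?_, ?_, ?_, ?_⟩
  · rw [hB]; rfl
  · rw [hB]; rfl
  · rw [hB]; rfl
  · rw [hB]; exact hN4 v
  · intro i hi1 hi2 hi3
    fin_cases i
    · rw [hB]; exact hN4 v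
    · exact absurd rfl hi1
    · exact absurd rfl hi2
    · exact absurd rfl hi3

end LinearAlgebra

/-- **JNF-4**: a LINEAR `σ` on `k[x₁,…,xₙ]`, `n ≤ 4`, with `(σ − 1)⁴ = 0` on the coordinates is
conjugate to the identity / an LSB datum (first disjunct), or to a `J₃`-with-passengers datum
(second), or to the Jordan block `J₄` (third; then `n = 4`). The first two come from JNF-3
(`LinearCubeZero.exists_conj_normalForm_of_cube_zero`) when `(σ − 1)³ = 0`; otherwise
`N = σ − 1` has `N³ ≠ 0 = N⁴` on the degree-one part and `(N³ v, N² v, N v, v)` is a basis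
(`exists_basis_of_pow_four`), realised by a coordinate change
(`LinearSqZero.exists_algEquiv_apply_X_eq`). [folklore; Jordan normal form] -/
theorem exists_conj_normalForm_of_pow_four (k : Type) [Field k] (n : ℕ) (hn : n ≤ 4)
    (σ : MvPolynomial (Fin n) k ≃ₐ[k] MvPolynomial (Fin n) k)
    (hlin : ∀ i, σ (X i) ∈ Submodule.span k (Set.range (X : Fin n → MvPolynomial (Fin n) k)))
    (hfour : ∀ i,
      σ (σ (σ (σ (X i) - X i) - (σ (X i) - X i)) - (σ (σ (X i) - X i) - (σ (X i) - X i))) =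
        σ (σ (σ (X i) - X i) - (σ (X i) - X i)) - (σ (σ (X i) - X i) - (σ (X i) - X i))) :
    ∃ τ : MvPolynomial (Fin n) k ≃ₐ[k] MvPolynomial (Fin n) k,
      (∃ (D : Finset (Fin n)) (f : Fin n → Fin n), (∀ i ∈ D, f i ∉ D) ∧
        (∀ i ∈ D, (τ * σ * τ⁻¹) (X i) = X i + X (f i)) ∧ (∀ i ∉ D, (τ * σ * τ⁻¹) (X i) = X i)) ∨
      (∃ a b c : Fin n, a ≠ b ∧ b ≠ c ∧ a ≠ c ∧
        (τ * σ * τ⁻¹) (X b) = X b + X a ∧ (τ * σ * τ⁻¹) (X c) = X c + X b ∧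
        ∀ i, i ≠ b → i ≠ c → (τ * σ * τ⁻¹) (X i) = X i) ∨
      (∃ a b c d : Fin n, a ≠ b ∧ a ≠ c ∧ a ≠ d ∧ b ≠ c ∧ b ≠ d ∧ c ≠ d ∧
        (τ * σ * τ⁻¹) (X b) = X b + X a ∧ (τ * σ * τ⁻¹) (X c) = X c + X b ∧
        (τ * σ * τ⁻¹) (X d) = X d + X c ∧
        ∀ i, i ≠ b → i ≠ c → i ≠ d → (τ * σ * τ⁻¹) (X i) = X i) := by
  classical
  by_cases hcube : ∀ i, σ (σ (σ (X i) - X i) - (σ (X i) - X i)) = σ (σ (X i) - X i) - (σ (X i) - X i)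
  · -- `(σ − 1)³ = 0`: JNF-3
    obtain ⟨τ, h⟩ := LinearCubeZero.exists_conj_normalForm_of_cube_zero k n hn σ hlin hcube
    rcases h with h | h
    · exact ⟨τ, Or.inl h⟩
    · exact ⟨τ, Or.inr (Or.inl h)⟩
  · -- `(σ − 1)³ ≠ 0`: one Jordan block `J₄`
    push Not at hcube
    obtain ⟨i₀, hi₀⟩ := hcube
    let L := Submodule.span k (Set.range (X : Fin n → MvPolynomial (Fin n) k))
    have hX : LinearIndependent k (X : Fin n → MvPolynomial (Fin n) k) :=
      MvPolynomial.linearIndependent_X _ _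
    let bX : Basis (Fin n) k L := Basis.span hX
    haveI : FiniteDimensional k L := Module.Finite.of_basis bX
    have hrank : Module.finrank k L = n := by
      rw [Module.finrank_eq_card_basis bX, Fintype.card_fin]
    -- `σ` restricted to the degree-one part, and `N = σ − 1` there
    have hσL : ∀ x ∈ L, σ.toLinearMap x ∈ L := by
      intro x hx
      have h : Submodule.map σ.toLinearMap L ≤ L := by
        change Submodule.map σ.toLinearMap (Submodule.span k _) ≤ L
        rw [Submodule.map_span_le]
        rintro _ ⟨i, rfl⟩
        exact hlin i
      exact h ⟨x, hx, rfl⟩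
    let N : L →ₗ[k] L := σ.toLinearMap.restrict hσL - LinearMap.id
    have hNval : ∀ x : L, ((N x : L) : MvPolynomial (Fin n) k) = σ x - x := fun x => rfl
    have hbX : ∀ i, ((bX i : L) : MvPolynomial (Fin n) k) = X i :=
      fun i => congrArg Subtype.val (Basis.span_apply hX i)
    have hN4 : ∀ x : L, N (N (N (N x))) = 0 := by
      have h : N ∘ₗ N ∘ₗ N ∘ₗ N = 0 := by
        refine bX.ext fun i => Subtype.ext ?_
        rw [LinearMap.comp_apply, LinearMap.comp_apply, LinearMap.comp_apply, hNval, hNval, hNval,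
          hNval, LinearMap.zero_apply, Submodule.coe_zero, hbX, hfour i, sub_self]
      intro x
      have hx := congrArg (fun g : L →ₗ[k] L => g x) h
      simpa only [LinearMap.comp_apply, LinearMap.zero_apply] using hx
    have hv : N (N (N (bX i₀))) ≠ 0 := by
      intro h
      apply hi₀
      have h' := congrArg Subtype.val h
      rw [hNval, hNval, hNval, hbX, Submodule.coe_zero] at h'
      exact sub_eq_zero.1 h'
    -- Jordan basis and the coordinate change
    obtain ⟨B, a, b, c, d, hab, hac, had, hbc, hbd, hcd, hd, hc, hb, -, hoff⟩ :=
      exists_basis_of_pow_four N hN4 (bX i₀) hv hrank hn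
    obtain ⟨φ, hφ⟩ := LinearSqZero.exists_algEquiv_apply_X_eq k n B
    have hσB : ∀ i, σ (B i : MvPolynomial (Fin n) k) = B i + N (B i) := by
      intro i
      rw [hNval, add_sub_cancel]
    refine ⟨φ.symm, Or.inr (Or.inr ⟨a, b, c, d, hab, hac, had, hbc, hbd, hcd, ?_, ?_, ?_,
      fun i hib hic hid => ?_⟩)⟩
    · rw [AlgEquiv.mul_apply, AlgEquiv.mul_apply, AlgEquiv.aut_inv, AlgEquiv.symm_symm, hφ, hσB,
        hb, ← hφ b, ← hφ a, ← map_add, AlgEquiv.symm_apply_apply]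
    · rw [AlgEquiv.mul_apply, AlgEquiv.mul_apply, AlgEquiv.aut_inv, AlgEquiv.symm_symm, hφ, hσB,
        hc, ← hφ c, ← hφ b, ← map_add, AlgEquiv.symm_apply_apply]
    · rw [AlgEquiv.mul_apply, AlgEquiv.mul_apply, AlgEquiv.aut_inv, AlgEquiv.symm_symm, hφ, hσB,
        hd, ← hφ d, ← hφ c, ← map_add, AlgEquiv.symm_apply_apply]
    · rw [AlgEquiv.mul_apply, AlgEquiv.mul_apply, AlgEquiv.aut_inv, AlgEquiv.symm_symm, hφ, hσB,
        hoff i hib hic hid, Submodule.coe_zero, add_zero, ← hφ i, AlgEquiv.symm_apply_apply]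

end Summit.ResolutionOfSingularities.ResolutionOfSingularities.Theorems.WildQuotientResolution.LinearPowFour

end
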